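import Summits.QuantumFields.YangMills.Theorems.BalabanUVNodesN08AlphaEq324RowACZero
import Summits.QuantumFields.YangMills.Theorems.BalabanUVNodesN08AlphaZeroDataRows
import Summits.QuantumFields.YangMills.Theorems.BalabanUVNodesN08AlphaEq324RowCumLetterZero

/-!
# Route «BalabanUVNodes», Track-A DAG node N08 = [Balaban1985UV3] Thm 1 p. 257 ∕ Thm 2 p. 272 — THE LOAD MAP OF THE EDITED (α)-AC CLAUSE AT ZERO
# EXPANSION DATA: on the road of record to N08's slot, the core (α)-AC clause with the (3.24) row in print's sandwich currency at ANY cumulant letter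
# (`…RowAC.RunAlphaEq324CoreLTAtAC`, p607065) IS, at the zero series, «weighted sums of the letter vanish ∧ the transported residual pair ∧ the class-I rows»

Cell `pub-ymgap`, seat `pub-ymgap-dag-n08-w4` gen 4 (WIDTH SEAT 4∕4 on N08; CLAIM-1∕INTENT-1 INBOX l.31078).  `bears_on: R4∕N08`; `--supports
stmt-QuantumFields-20542` (K1⁷, helper).  THEOREMS ONLY (def-free), sorry-free, standard axioms; the lane's `Balaban3D/Proofs/*AC` modules, dag-n08-d g6's
zero data (`…N08AlphaZeroData{,Rows}`: `zeroRun`, the empty graph carrier, `gaussLog_of_isEmpty`, `posSemidef_real_of_isEmpty`, `RunRowsI`) and gen 3's zero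
range-honest AC bundle (`…RowACZero.zeroAlphaLTAC`) consumed BY NAME.

THE LOCATED POINT (AC twin of dag-n08-d g6's `stepDataRows_zero_iff`∕`runAlpha_zero_iff` and of gen 2's `…RowCumLetterZero.coreLTAt_zero_iff`).  The road of
record to `Node00.PrintedUV3V N L` is p608282∕p609560's END over the edition `RunAlphaEq324CoreLTAtAC 𝔊 𝔠 X 𝔖 𝔄 c`: per run step sixteen DATA rows (G3D-01∕04∕05∕06
binders, (26), (28), the identifications `hPY`∕`hPYZ`∕`hact`, `Pint` measurable and bounded at `inputOfAC`), the printed (3.24) sandwich `h324` and G3D-02 `hG` at the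
letter `c`, the class-I rows `hU`∕`h44`∕`hfloor`, and the RESIDUAL PAIR R3D-01∕02 in TRANSPORTED form over the UNCAPPED exact-transport masses `massRecAC`
(`Bound55AC.Fibre49AC`∕`Fibre57LowAC`); plus (67)∕(68).  WHICH of these can tell Bałaban's expansion from NO expansion at all, on the AC road?
* §1 zero-data leaves at the AC carriers: `piecesAC_zeroRun_logZT∕_logFl∕_Pold`, `piecesWAC_zeroRun_*`, ★ `inputOfAC_zeroRun_Pint` (the (43) interaction sum of the
  AC tower input VANISHES), `norm35_piecesAC_zeroRun` ∕ `logZT_piecesAC_zeroRun` (G3D-04∕05 model data EXIST at the zero AC pieces: no Gaussian variables).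
* §2 ★ `stepCoreLTAtAC_zero_iff`: at the zero series, the zero range-honest AC bundle and ANY AC external inputs `X`, on a family member (`g²ε₀ ≤ 1`, EVERY record —
  no `hfar`, NO sign hypothesis on `Ca`∕`Cc` since the edition carries the sandwich, not the tilted pair), the edited step list at letter `c` HOLDS IFF the weighted
  sums `Σ_{n≤n̄} c k h U n∕n!` vanish (forced by the EMPTY graph carrier through `hG`) ∧ the transported residual pair ∧ `U_k(·,h)` measurable; ★★ `coreLTAtAC_zero_iff`:
  the run clause IS «sums vanish on the run ∧ residual pairs AC ∧ `RunRowsI 𝔊 𝔠 X.axialCompanion (zeroRun 𝔊 𝔠)`» — the class-I rows READ THE MINIMISERS `X.UkH` ONLY,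
  never the averaging, so dag-n08-d's schema at the axial companion states them verbatim; `coreLTAtAC_zero_of_pairs`; the lane's χ-letter and the FREE moment-cumulant
  letter (what a [BenfattoEtAl1978]∕class supplier speaks) have vanishing sums: `coreLTAtAC_zero_cum_iff`, `coreLTAtAC_zero_freeLetter_iff`.
* §3 what the AC residual pair READS at zero data — ★ `fibre49AC_zeroRun_iff` ∕ ★ `fibre57LowAC_zeroRun_iff`: print's (55)·(58) and the lower step bound in transported
  form, `log Z^{(k)}`, `Σ𝒫_j`, `log Fl`, `Pint` ALL ZERO — the (62) normalisation `(σ₀ g_k^{d(𝔤)})^{|B*|}` alone against the minimisers' Boltzmann factors and the exact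
  transports `T_k(Ū)` (uncapped rnDeriv masses inside both sides); not decided here for any `X`.
READING (R-AC-ZERO; count-neutral, owners decide): on the road of record too, every G3D binder «as cited», (26)∕(28), the identifications, the printed (3.24) sandwich at
any letter with vanishing sums and `Pint`'s rows are satisfied by NO expansion at all — the AC clause's quantitative content sits ENTIRELY in the transported residual pair
and the minimiser rows (67)∕(68)∕`hU`; a supplier's non-vacuity certificate must start at `Fibre49AC`∕`Fibre57LowAC` with non-zero Gaussian data.
HONEST SCOPE.  Kernel statements about the TYPING of the AC (α) clause at test data; the zero series is NOT Bałaban's expansion and nothing here claims it meets the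
residual pair; nothing of [B10] asserted; N08 NOT discharged; count-neutral; one finite 𝕋⁴ programme at fixed ε — R4 closes the conditional finite-𝕋⁴ rung
`BalabanLadder.UV` only; nothing about d = 4, the continuum, OS axioms, a mass gap or Clay.  References: [Balaban1985UV3] T. Bałaban, Commun. Math. Phys. 102 (1985)
255–275 — (35) p. 265, (41)–(43) p. 266, (47) p. 267, (49)–(58) pp. 268–270, (62)–(63) pp. 271–272, (67)–(68) p. 273; [Balaban1982Higgs1] (3.24) p. 616; [BenfattoEtAl1978] (2.7) p. 147.
-/

noncomputable section

namespace Summit.QuantumFields.YangMills.Theorems.BalabanUVNodesN08AlphaEq324RowACZeroRows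

open MeasureTheory ProbabilityTheory Metric
open scoped BigOperators Matrix Nat
open Literature.MathematicalPhysics.QuantumFieldTheory.Balaban1983to89
open Literature.MathematicalPhysics.QuantumFieldTheory.Balaban1983to89.B10
open Literature.MathematicalPhysics.QuantumFieldTheory.Balaban1983to89.TreeLengthTorus (tsys)
open Literature.MathematicalPhysics.QuantumFieldTheory.Balaban1983to89.B1Sect3Statements (Eq324)
open Literature.MathematicalPhysics.QuantumFieldTheory.Balaban1983to89.AveragingRT (rnTransport)
open Literature.MathematicalPhysics.QuantumFieldTheory.Balaban1985CMP102
open Literature.MathematicalPhysics.QuantumFieldTheory.Balaban1985CMP102.Setting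
open Literature.MathematicalPhysics.QuantumFieldTheory.Balaban1985CMP102.Binders
  (ChartAnalyticityAsCited FarTermsDecayAsCited Norm35StepAsCited LogZTExtensiveAsCited LogZTModel GraphRep23AsCited LogZLocalizedAsCited)
open Literature.Probability.LatticeModels (cumulantOf)
open Summit.QuantumFields.Balaban3D.Carriers
open Summit.QuantumFields.Balaban3D.Proofs
open Summit.QuantumFields.Balaban3D.Proofs.ScalesArithmetic
open Summit.QuantumFields.Balaban3D.Proofs.Inputs
open Summit.QuantumFields.Balaban3D.Proofs.Primitives
open Summit.QuantumFields.Balaban3D.Proofs.GroupModelLieC (lieC)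
open Summit.QuantumFields.Balaban3D.Proofs.UVStability3DInputs (adjAct)
open Summit.QuantumFields.Balaban3D.Proofs.Representation33 (jet26 jet26_apply_zero)
open Summit.QuantumFields.Balaban3D.Proofs.VacuumAndBooking (rFun_nonneg)
open Summit.QuantumFields.Balaban3D.Proofs.Bound55Masses (chiB)
open Summit.QuantumFields.Balaban3D.Proofs.StandardAC
open Summit.QuantumFields.Balaban3D.Proofs.InputsAC
open Summit.QuantumFields.Balaban3D.Proofs.Bound55AC
open Summit.QuantumFields.Balaban3D.Proofs.AlphaAC
open Summit.QuantumFields.YangMills.Theorems.BalabanUVNodesN08AlphaClassI (RunRowsI StepRowsI)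
open Summit.QuantumFields.YangMills.Theorems.BalabanUVNodesN08AlphaZeroData
open Summit.QuantumFields.YangMills.Theorems.BalabanUVNodesN08AlphaZeroDataRows (posSemidef_real_of_isEmpty stepRowsI_zero_iff)
open Summit.QuantumFields.YangMills.Theorems.BalabanUVNodesN08AlphaEq324RowAC
open Summit.QuantumFields.YangMills.Theorems.BalabanUVNodesN08AlphaEq324RowACZero
open Summit.QuantumFields.YangMills.Theorems.BalabanUVNodesN08AlphaEq324RowCumLetterZero (moments_zeroRun freeLetter_zeroRun_eq_zero)

variable {L : ℕ}

/-! ## §1 Zero-data leaves at the AC carriers -/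
section Leaves

variable {S : Scales L} {G : Type} [GaugeGroup G] [MeasurableSpace G] [HaarData G] (𝔊 : GroupModel G) (𝔠 : AlphaConsts L 𝔊.N)
  (X : ExternalInputsAC S G)

/-- `log Z^{(k)}(T₁^{(k)}, 1)` of the lane's AC pieces vanishes at zero data. [folklore] -/
@[simp] theorem piecesAC_zeroRun_logZT (k : ℕ) : (piecesAC 𝔠.lane X (zeroRun 𝔊 𝔠) k).logZT = 0 :=
  zeroSeries_logZT (S := S) (G := G) (V := ↥(lieC 𝔊)) (N := nblkOf S 𝔠.lane.carrier k) (k := k)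

/-- The fluctuation logarithm of (58) of the lane's AC pieces vanishes at zero data. [folklore] -/
@[simp] theorem piecesAC_zeroRun_logFl (k : ℕ) (h : Hist S.P (k + 1)) (U : GaugeField S.P (k + 1) G) :
    (piecesAC 𝔠.lane X (zeroRun 𝔊 𝔠) k).logFl h U = 0 :=
  zeroSeries_logFl (S := S) (G := G) (V := ↥(lieC 𝔊)) (N := nblkOf S 𝔠.lane.carrier k) h U

/-- The previous-scale sum «Σ_{j=1}^k Σ_{Y_j} 𝒫_j(Y_j, U_{k+1})» of the lane's AC pieces vanishes at zero data. [cite: Balaban1985UV3, (58) p.270] -/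
@[simp] theorem piecesAC_zeroRun_Pold (k : ℕ) (h : Hist S.P (k + 1)) (U : GaugeField S.P (k + 1) G) :
    (piecesAC 𝔠.lane X (zeroRun 𝔊 𝔠) k).Pold h U = 0 := by
  show (zeroRun 𝔊 𝔠 k).Pold 𝔠.lane.carrier.M₁ (rcolOf S 𝔠.lane.carrier) h U = 0
  rw [StepSeries.Pold, oldSum]
  simp

/-- ★ **THE INTERACTION SUM (43) OF THE AC TOWER INPUT VANISHES AT ZERO DATA**: `Pint k h U = 0` for `inputOfAC 𝔠.lane X (zeroRun 𝔊 𝔠)` (no previous-scale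
terms, no new polymer sums; `SeriesAC.TowerBaseAC.withSeriesAC_Pint_succ`). [cite: Balaban1985UV3, (43) p.266] -/
@[simp] theorem inputOfAC_zeroRun_Pint : ∀ (k : ℕ) (h : Hist S.P k) (U : GaugeField S.P k G),
    (inputOfAC 𝔠.lane X (zeroRun 𝔊 𝔠)).Pint k h U = 0
  | 0, _, _ => rfl
  | k + 1, h, U => by
    show (zeroRun 𝔊 𝔠 k).PoldIn 𝔠.lane.carrier.M₁ (rcolOf S 𝔠.lane.carrier) h U + 0 + 0 = 0
    rw [add_zero, add_zero, StepSeries.PoldIn, oldSumIn]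
    simp

/-- The interaction sum of the STANDARD AC tower input vanishes at zero data (`inputOfAC_zeroRun_Pint` in `Bound55AC`'s spelling). [cite: Balaban1985UV3, (43) p.266] -/
@[simp] theorem stdTowerInputAC_zeroRun_Pint (k : ℕ) (h : Hist S.P k) (U : GaugeField S.P k G) :
    (stdTowerInputAC X 𝔠.lane.carrier (zeroRun 𝔊 𝔠)).Pint k h U = 0 :=
  inputOfAC_zeroRun_Pint 𝔊 𝔠 X k h U

/-- `log Z^{(k)}(B(Λ_{k+1}), U_{k+1})` of the unpinned AC pieces vanishes at zero data. [folklore] -/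
@[simp] theorem piecesWAC_zeroRun_logZU (k : ℕ) (h : Hist S.P (k + 1)) (U : GaugeField S.P (k + 1) G) :
    (piecesWAC 𝔠.lane X (zeroRun 𝔊 𝔠) k).logZU h U = 0 :=
  piecesAC_zeroRun_logZU 𝔊 𝔠 X k h U

/-- The fluctuation logarithm of the unpinned AC pieces vanishes at zero data. [folklore] -/
@[simp] theorem piecesWAC_zeroRun_logFl (k : ℕ) (h : Hist S.P (k + 1)) (U : GaugeField S.P (k + 1) G) :
    (piecesWAC 𝔠.lane X (zeroRun 𝔊 𝔠) k).logFl h U = 0 :=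
  piecesAC_zeroRun_logFl 𝔊 𝔠 X k h U

/-- The previous-scale sum of the unpinned AC pieces vanishes at zero data. [cite: Balaban1985UV3, (58) p.270] -/
@[simp] theorem piecesWAC_zeroRun_Pold (k : ℕ) (h : Hist S.P (k + 1)) (U : GaugeField S.P (k + 1) G) :
    (piecesWAC 𝔠.lane X (zeroRun 𝔊 𝔠) k).Pold h U = 0 :=
  piecesAC_zeroRun_Pold 𝔊 𝔠 X k h U

/-- The unpinned AC pieces carry the record's `log σ₀` (`rfl`). [cite: Balaban1985UV3, (18) p.260] -/
theorem piecesWAC_zeroRun_logσ₀ (k : ℕ) : (piecesWAC 𝔠.lane X (zeroRun 𝔊 𝔠) k).logσ₀ = 𝔠.logσ₀ := rfl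

/-- The unpinned AC pieces carry the record's `d(𝔤)` (`rfl`). [cite: Balaban1985UV3, (22) p.261] -/
theorem piecesWAC_zeroRun_dg (k : ℕ) : (piecesWAC 𝔠.lane X (zeroRun 𝔊 𝔠) k).dg = (𝔠.dimg : ℝ) := rfl

/-- The unpinned AC pieces project histories by `Hist.proj` (`rfl`). [folklore] -/
theorem piecesWAC_zeroRun_proj (k : ℕ) (h' : Hist S.P (k + 1)) : (piecesWAC 𝔠.lane X (zeroRun 𝔊 𝔠) k).proj h' = h'.proj := rfl

/-- **G3D-04's MODEL DATA EXIST AT THE ZERO AC PIECES**, per history: empty core, no extra coordinates, Jacobian constants `0` (`log Z^{(k)}(·,1) = 0 = 0 + log ∫_{ℝ⁰} 1`).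
[cite: Balaban1985UV3, (35) p.265] -/
theorem norm35_piecesAC_zeroRun (k : ℕ) : Norm35StepAsCited (piecesAC 𝔠.lane X (zeroRun 𝔊 𝔠) k) 𝔠.c35 𝔠.a35 𝔠.cv 𝔠.cJ35 := fun h =>
  ⟨{ r := 0, s := 0, t := 0, K := 0, B₁ := 0, D₁ := 0, B₂ := 0, D₂ := 0, J₁ := 0, J₂ := 0
     lower₁ := posSemidef_real_of_isEmpty _
     upper₁ := posSemidef_real_of_isEmpty _
     lower₂ := posSemidef_real_of_isEmpty _
     upper₂ := posSemidef_real_of_isEmpty _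
     logZ1_eq := by rw [piecesAC_zeroRun_logZ1, gaussLog_of_isEmpty, add_zero]
     logZT_eq := by rw [piecesAC_zeroRun_logZT, gaussLog_of_isEmpty, add_zero]
     count_le := by
       have := mul_nonneg 𝔠.cv_nonneg ((piecesAC 𝔠.lane X (zeroRun 𝔊 𝔠) k).Zvol_nonneg h)
       simpa using this
     jac_le := by
       have := mul_nonneg 𝔠.cJ35_nonneg ((piecesAC 𝔠.lane X (zeroRun 𝔊 𝔠) k).Zvol_nonneg h)
       simpa using this }⟩

/-- **G3D-05's MODEL DATA EXIST AT THE ZERO AC PIECES**: no Gaussian variables, Jacobian constant `0`. [cite: Balaban1985UV3, (62) p.271 + (65) p.273] -/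
theorem logZT_piecesAC_zeroRun (k : ℕ) : LogZTExtensiveAsCited (piecesAC 𝔠.lane X (zeroRun 𝔊 𝔠) k) 𝔠.cT 𝔠.aT 𝔠.cn 𝔠.cJT :=
  ⟨{ dim := 0, Q := 0, J := 0
     lower := posSemidef_real_of_isEmpty _
     upper := posSemidef_real_of_isEmpty _
     logZT_eq := by rw [piecesAC_zeroRun_logZT, gaussLog_of_isEmpty, add_zero]
     count_le := by
       show ((0 : ℕ) : ℝ) ≤ 𝔠.cn * S.sites k
       simpa using mul_nonneg 𝔠.cn_nonneg (sites_nonneg S k)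
     jac_le := by
       show |(0 : ℝ)| ≤ 𝔠.cJT * S.sites k
       simpa using mul_nonneg 𝔠.cJT_nonneg (sites_nonneg S k) }⟩

end Leaves

/-! ## §2 The edited (α)-AC clause at zero data, any letter -/
section Zero

variable {S : Scales L} {G : Type} [GaugeGroup G] [MeasurableSpace G] [HaarData G] (𝔊 : GroupModel G) (𝔠 : AlphaConsts L 𝔊.N)
  (X : ExternalInputsAC S G) (c : ∀ k, Hist S.P (k + 1) → GaugeField S.P (k + 1) G → ℕ → ℝ)

open Classical in
/-- ★ **THE EDITED (α)-AC STEP LIST AT ZERO DATA, ANY LETTER, IS «sums of the letter vanish ∧ transported residual pair ∧ measurable minimisers»**: at the zero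
series, the zero range-honest AC bundle `zeroAlphaLTAC` and ANY AC external inputs `X`, on a family member `g²ε₀ ≤ 1` (EVERY record: no `hfar`, no sign of `Ca`∕`Cc`),
`StepAlphaEq324CoreLTAtAC … c k hk` holds IFF (i) `Σ_{n∈Icc 1 n̄} c k h U n∕n! = 0` for all `(h, U)` (forced by the EMPTY graph carrier of the zero series through G3D-02
`hG`; then the printed sandwich `h324` holds with remainder `0`: `∫_{univ} e⁰ dδ = 1 = e⁰`), (ii) the residual rows R3D-01 `Fibre49AC` (every new history) and R3D-02
`Fibre57LowAC`, (iii) `U_k(·,h)` measurable — the fourteen other rows (G3D-01∕04∕05∕06 binders, (26), (28), `hPY`∕`hPYZ`∕`hact`, (44), the degree floor, `Pint`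
measurable and `≤ cP = 0`) hold for zero data. [cite: Balaban1985UV3, (41) p.266 + (55)–(63) pp.269–272; Balaban1982Higgs1, (3.24) p.616] -/
theorem stepCoreLTAtAC_zero_iff (hle : S.g ^ 2 * S.ε₀ ≤ 1) {k : ℕ} (hk : k + 1 ≤ S.K) :
    StepAlphaEq324CoreLTAtAC 𝔊 𝔠 X (zeroRun 𝔊 𝔠) (zeroAlphaLTAC 𝔊 𝔠 X hle) c k hk ↔
      (∀ h (U : GaugeField S.P (k + 1) G), ∑ n ∈ Finset.Icc 1 𝔠.nbar, c k h U n / (n.factorial : ℝ) = 0) ∧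
      ((∀ h' : Hist S.P (k + 1),
          Fibre49AC X 𝔠.lane.carrier (zeroRun 𝔊 𝔠) (fun _ => True) k (piecesWAC 𝔠.lane X (zeroRun 𝔊 𝔠) k) h') ∧
        Fibre57LowAC X 𝔠.lane.carrier (zeroRun 𝔊 𝔠) (fun _ => True) k (piecesWAC 𝔠.lane X (zeroRun 𝔊 𝔠) k)) ∧
      ∀ h : Hist S.P k, Measurable (X.UkH k h) := by
  refine ⟨fun A => ⟨fun h U => by simpa [zeroSeries_Gt_supp] using (A.hG h).1 U, ⟨A.fibre49, A.fibre57Low⟩, A.hU⟩, fun ⟨hsum, Hres, HU⟩ => ?_⟩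
  have hg1 : S.gk k ≤ 1 := gk_le_one S hle k (by omega)
  have hg : 0 < S.gk k := gk_pos S k
  have hrp := rFun_mul_pFun_nonneg 𝔠 hg1
  exact
    { chart := fun Y => ⟨𝔠.ρ_pos, differentiableOn_const _, fun z _ => by
        show ‖(0 : ℂ)‖ ≤ _
        rw [norm_zero]
        exact mul_nonneg (mul_nonneg 𝔠.C25_nonneg hg.le) (Real.exp_pos _).le⟩
      bound28 := fun Y h U => by
        show ‖(0 : PBond S.P k → ↥(lieC 𝔊))‖ ≤ _
        rw [norm_zero]
        exact mul_nonneg 𝔠.cB_nonneg (mul_nonneg (mul_nonneg (rFun_nonneg 𝔠.r₀ _ hg hg1) hg.le)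
          (pFun_nonneg 𝔠.b₀ 𝔠.p₀ (S.gk k) 𝔠.b₀_pos.le hg hg1))
      inv26 := fun _ _ _ _ _ => rfl
      far_le := fun Y h U => by
        show |(0 : ℝ)| ≤ _
        rw [abs_zero]
        exact mul_nonneg 𝔠.Cfar_nonneg (mul_nonneg (mul_nonneg (mul_nonneg 𝔠.C25_nonneg hg.le) (Real.exp_pos _).le)
          (mul_nonneg (pow_nonneg hg.le _) (pow_nonneg hrp _)))
      hPY := fun h U => by simp [jet26_apply_zero]
      hPYZ := fun h U => by simp [jet26_apply_zero]
      norm35 := norm35_piecesAC_zeroRun 𝔊 𝔠 X k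
      logZT := logZT_piecesAC_zeroRun 𝔊 𝔠 X k
      hact := fun h Y U => by
        rw [zeroSeries_act]
        exact zeroGraphTerms_act Y U
      hG := fun h =>
        ⟨fun U => by simp [hsum h U], fun γ hγ => by simp at hγ, fun γ hγ => by simp at hγ, fun γ hγ => by simp at hγ⟩
      h324 := fun h U => by
        have hrem : 0 ≤ (𝔠.Ca + 𝔠.Cc) * ((L : ℝ) ^ k * S.g0sq) ^ (3 + 𝔠.κ₀) * S.sites k :=
          mul_nonneg (mul_nonneg 𝔠.Cac_nonneg (Real.rpow_nonneg (mul_nonneg (pow_nonneg (Nat.cast_nonneg _) _)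
            (g0sq_pos S).le) _)) (sites_nonneg S k)
        refine ⟨0, by rw [abs_zero]; exact hrem, ?_⟩
        rw [hsum h U]
        show ∫ _ω in (Set.univ : Set Unit), Real.exp 0 ∂(Measure.dirac ()) = _
        simp
      h44 := fun h U j _ y n c' => by
        show |(0 : ℝ)| ≤ _
        rw [abs_zero]
        refine mul_nonneg 𝔠.C44_nonneg (Finset.prod_nonneg fun i _ => mul_nonneg (Real.exp_pos _).le (mul_nonneg ?_ ?_))
        · exact mul_nonneg (inv_nonneg.2 (ell_pos S.P k j).le) (oldGeom_dist_nonneg S.P k j _ _)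
        · have := pFun_nonneg 𝔠.b₀ 𝔠.p₀ (S.gk k) 𝔠.b₀_pos.le hg hg1
          have hB := 𝔠.B₃_pos
          positivity
      hfloor := fun h U j _ y n c' hne => (hne rfl).elim
      hU := HU
      hPm := fun h => by
        rw [show (inputOfAC 𝔠.lane X (zeroRun 𝔊 𝔠)).Pint k h = fun _ => 0 from funext (inputOfAC_zeroRun_Pint 𝔊 𝔠 X k h)]
        exact measurable_const
      hPb := fun h U => by rw [inputOfAC_zeroRun_Pint]; exact le_rfl
      fibre49 := Hres.1
      fibre57Low := Hres.2 }

/-- **AN INHABITANT OF THE EDITED STEP LIST at zero data for every letter with vanishing sums, modulo the transported residual pair and `hU`** (the `←` half, named).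
[cite: Balaban1985UV3, (41) p.266 (bookkeeping)] -/
theorem stepCoreLTAtAC_zero_of_pair (hle : S.g ^ 2 * S.ε₀ ≤ 1) {k : ℕ} (hk : k + 1 ≤ S.K)
    (hsum : ∀ h (U : GaugeField S.P (k + 1) G), ∑ n ∈ Finset.Icc 1 𝔠.nbar, c k h U n / (n.factorial : ℝ) = 0)
    (H : (∀ h' : Hist S.P (k + 1),
          Fibre49AC X 𝔠.lane.carrier (zeroRun 𝔊 𝔠) (fun _ => True) k (piecesWAC 𝔠.lane X (zeroRun 𝔊 𝔠) k) h') ∧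
        Fibre57LowAC X 𝔠.lane.carrier (zeroRun 𝔊 𝔠) (fun _ => True) k (piecesWAC 𝔠.lane X (zeroRun 𝔊 𝔠) k))
    (hU : ∀ h : Hist S.P k, Measurable (X.UkH k h)) :
    StepAlphaEq324CoreLTAtAC 𝔊 𝔠 X (zeroRun 𝔊 𝔠) (zeroAlphaLTAC 𝔊 𝔠 X hle) c k hk :=
  (stepCoreLTAtAC_zero_iff 𝔊 𝔠 X c hle hk).2 ⟨hsum, H, hU⟩

variable [MeasurableMul₂ G]

/-- **The class-I step rows at the AXIAL COMPANION are the class-I step rows of the AC inputs** (they read the minimisers `X.UkH` and the data `𝔖` only; `rfl` on the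
fields). [cite: Balaban1985UV3, (42) p.266 + (44) p.267 (bookkeeping)] -/
theorem stepRowsI_axialCompanion_iff (𝔖 : ∀ k, StepSeries S G ↥(lieC 𝔊) (nblkOf S 𝔠.lane.carrier k) k) (k : ℕ) :
    StepRowsI 𝔊 𝔠 X.axialCompanion 𝔖 k ↔
      (∀ h : Hist S.P k, Measurable (X.UkH k h)) ∧
      (∀ (h : Hist S.P (k + 1)) (U : GaugeField S.P (k + 1) G), ∀ j ∈ Finset.Icc 1 k,
        B10SectCExpansion.Bound44 (oldGeom S.P k j) (fun y n c' => (𝔖 k).oldVal h U j y n c') 𝔠.κ₁ (𝔠.M₁ : ℝ) (ell S.P k j) (L : ℝ) 𝔠.B₃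
          (S.gk k) (pFun 𝔠.b₀ 𝔠.p₀ (S.gk k)) 𝔠.C44) ∧
      (∀ (h : Hist S.P (k + 1)) (U : GaugeField S.P (k + 1) G), ∀ j ∈ Finset.Icc 1 k,
        ∀ (y : Site S.P j) (n : ℕ) (c' : Fin n → PBond S.P j), (𝔖 k).oldVal h U j y n c' ≠ 0 → 2 ≤ n) :=
  ⟨fun I => ⟨I.hU, I.h44, I.hfloor⟩, fun I => ⟨I.1, I.2.1, I.2.2⟩⟩

/-- ★★ **THE EDITED (α)-AC RUN CLAUSE AT ZERO DATA, ANY LETTER = «sums vanish on the run ∧ transported residual pairs ∧ the class-I rows»**, for EVERY record: on a family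
member `g²ε₀ ≤ 1`, `RunAlphaEq324CoreLTAtAC 𝔊 𝔠 X (zeroRun 𝔊 𝔠) (zeroAlphaLTAC …) c` holds IFF (i) the weighted sums of `c` vanish at every run step, (ii) for every `k < K`
the transported residual rows R3D-01∕R3D-02 hold, and (iii) the class-I rows of the run hold — which READ THE MINIMISERS `X.UkH` ONLY (dag-n08-d's `RunRowsI` at the axial
companion `X.axialCompanion`: `hU`, (44)∕floor — automatic at zero data —, (67) ∘ large field, (68)).  So on the road of record every displayed DATA row of the AC clause other
than the fibre inequalities is satisfied by NO expansion at all. [cite: Balaban1985UV3, (41) p.266 + (47) p.267 + (67)–(68) p.273] -/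
theorem coreLTAtAC_zero_iff (hle : S.g ^ 2 * S.ε₀ ≤ 1) :
    RunAlphaEq324CoreLTAtAC 𝔊 𝔠 X (zeroRun 𝔊 𝔠) (zeroAlphaLTAC 𝔊 𝔠 X hle) c ↔
      (∀ k, k + 1 ≤ S.K → ∀ h (U : GaugeField S.P (k + 1) G), ∑ n ∈ Finset.Icc 1 𝔠.nbar, c k h U n / (n.factorial : ℝ) = 0) ∧
      (∀ k, k + 1 ≤ S.K →
        (∀ h' : Hist S.P (k + 1),
            Fibre49AC X 𝔠.lane.carrier (zeroRun 𝔊 𝔠) (fun _ => True) k (piecesWAC 𝔠.lane X (zeroRun 𝔊 𝔠) k) h') ∧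
          Fibre57LowAC X 𝔠.lane.carrier (zeroRun 𝔊 𝔠) (fun _ => True) k (piecesWAC 𝔠.lane X (zeroRun 𝔊 𝔠) k)) ∧
      RunRowsI 𝔊 𝔠 X.axialCompanion (zeroRun 𝔊 𝔠) := by
  constructor
  · intro R
    refine ⟨fun k hk => ((stepCoreLTAtAC_zero_iff 𝔊 𝔠 X c hle hk).1 (R.steps k hk)).1,
      fun k hk => ((stepCoreLTAtAC_zero_iff 𝔊 𝔠 X c hle hk).1 (R.steps k hk)).2.1, ⟨fun k hk => ?_, R.hLF67, R.h68⟩⟩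
    exact (stepRowsI_zero_iff 𝔊 𝔠 X.axialCompanion (gk_le_one S hle k (by omega))).2
      ((stepCoreLTAtAC_zero_iff 𝔊 𝔠 X c hle hk).1 (R.steps k hk)).2.2
  · rintro ⟨hsum, H, I⟩
    exact ⟨fun k hk => (stepCoreLTAtAC_zero_iff 𝔊 𝔠 X c hle hk).2 ⟨hsum k hk, H k hk, (I.steps k hk).hU⟩, I.hLF67, I.h68⟩

/-- **AN INHABITANT OF THE ROAD OF RECORD'S ANTECEDENT FOR EVERY RECORD AND EVERY LETTER WITH VANISHING SUMS ON THE ZERO RUN**, modulo the transported residual pairs and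
the class-I rows (A6 status of p608282's `printedUV3V_at_slotOfRecord_of_coreLTAtAC_of_lf_of_consts` and p609560's `…_of_massBound_…`, uniform in the record).
[cite: Balaban1985UV3, (41) p.266 (bookkeeping)] -/
theorem coreLTAtAC_zero_of_pairs (hle : S.g ^ 2 * S.ε₀ ≤ 1)
    (hsum : ∀ k, k + 1 ≤ S.K → ∀ h (U : GaugeField S.P (k + 1) G), ∑ n ∈ Finset.Icc 1 𝔠.nbar, c k h U n / (n.factorial : ℝ) = 0)
    (H : ∀ k, k + 1 ≤ S.K →
      (∀ h' : Hist S.P (k + 1),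
          Fibre49AC X 𝔠.lane.carrier (zeroRun 𝔊 𝔠) (fun _ => True) k (piecesWAC 𝔠.lane X (zeroRun 𝔊 𝔠) k) h') ∧
        Fibre57LowAC X 𝔠.lane.carrier (zeroRun 𝔊 𝔠) (fun _ => True) k (piecesWAC 𝔠.lane X (zeroRun 𝔊 𝔠) k))
    (I : RunRowsI 𝔊 𝔠 X.axialCompanion (zeroRun 𝔊 𝔠)) :
    ∃ 𝔄 : AlphaDataLTAC 𝔊 𝔠 X (zeroRun 𝔊 𝔠), RunAlphaEq324CoreLTAtAC 𝔊 𝔠 X (zeroRun 𝔊 𝔠) 𝔄 c :=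
  ⟨zeroAlphaLTAC 𝔊 𝔠 X hle, (coreLTAtAC_zero_iff 𝔊 𝔠 X c hle).2 ⟨hsum, H, I⟩⟩

omit c in
/-- **AT THE LANE'S χ-LETTER `(𝔖 ·).cum`** (the letter of p607065's `coreLTAtAC_cum_of_runAlphaAC`, i.e. of (R4‴) read through the edition) the first conjunct is automatic:
the printed cumulants of the zero potential vanish. [cite: Balaban1985UV3, (24) p.262 + (41) p.266] -/
theorem coreLTAtAC_zero_cum_iff (hle : S.g ^ 2 * S.ε₀ ≤ 1) :
    RunAlphaEq324CoreLTAtAC 𝔊 𝔠 X (zeroRun 𝔊 𝔠) (zeroAlphaLTAC 𝔊 𝔠 X hle) (fun k => (zeroRun 𝔊 𝔠 k).cum) ↔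
      (∀ k, k + 1 ≤ S.K →
        (∀ h' : Hist S.P (k + 1),
            Fibre49AC X 𝔠.lane.carrier (zeroRun 𝔊 𝔠) (fun _ => True) k (piecesWAC 𝔠.lane X (zeroRun 𝔊 𝔠) k) h') ∧
          Fibre57LowAC X 𝔠.lane.carrier (zeroRun 𝔊 𝔠) (fun _ => True) k (piecesWAC 𝔠.lane X (zeroRun 𝔊 𝔠) k)) ∧
      RunRowsI 𝔊 𝔠 X.axialCompanion (zeroRun 𝔊 𝔠) := by
  rw [coreLTAtAC_zero_iff]
  exact ⟨fun h => h.2, fun h => ⟨fun k _ h' U => BalabanUVNodesN08AlphaEq324RowCumLetterZero.sum_cum_zeroRun 𝔊 𝔠 k h' U, h⟩⟩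

omit c in
/-- ★ **AT THE FREE MOMENT-CUMULANT LETTER** `c k h U n := cumulantOf (m ↦ ∫ 𝒱ᵐ dμ) n` — the letter a [BenfattoEtAl1978]∕class sandwich supplier speaks (gen 2's CONSUMER
SPEC) — the first conjunct is again automatic at zero data (`freeLetter_zeroRun_eq_zero`): the road of record's antecedent at the supplier's letter has, for EVERY record, the
same zero-data inhabitants as at the lane's letter — the transported residual pairs and the class-I rows, nothing else. [cite: Balaban1985UV3, (41) p.266; BenfattoEtAl1978, (2.7) p.147] -/
theorem coreLTAtAC_zero_freeLetter_iff (hle : S.g ^ 2 * S.ε₀ ≤ 1) :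
    RunAlphaEq324CoreLTAtAC 𝔊 𝔠 X (zeroRun 𝔊 𝔠) (zeroAlphaLTAC 𝔊 𝔠 X hle)
        (fun k h U n => cumulantOf (fun m => ∫ ω, (zeroRun 𝔊 𝔠 k).𝒱 h U ω ^ m ∂(zeroRun 𝔊 𝔠 k).μ) n) ↔
      (∀ k, k + 1 ≤ S.K →
        (∀ h' : Hist S.P (k + 1),
            Fibre49AC X 𝔠.lane.carrier (zeroRun 𝔊 𝔠) (fun _ => True) k (piecesWAC 𝔠.lane X (zeroRun 𝔊 𝔠) k) h') ∧
          Fibre57LowAC X 𝔠.lane.carrier (zeroRun 𝔊 𝔠) (fun _ => True) k (piecesWAC 𝔠.lane X (zeroRun 𝔊 𝔠) k)) ∧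
      RunRowsI 𝔊 𝔠 X.axialCompanion (zeroRun 𝔊 𝔠) := by
  have hsum : ∀ k, k + 1 ≤ S.K → ∀ h (U : GaugeField S.P (k + 1) G),
      ∑ n ∈ Finset.Icc 1 𝔠.nbar, cumulantOf (fun m => ∫ ω, (zeroRun 𝔊 𝔠 k).𝒱 h U ω ^ m ∂(zeroRun 𝔊 𝔠 k).μ) n / (n.factorial : ℝ) = 0 :=
    fun k _ h U => Finset.sum_eq_zero fun n hn => by
      rw [freeLetter_zeroRun_eq_zero 𝔊 𝔠 k h U (Finset.mem_Icc.1 hn).1, zero_div]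
  rw [coreLTAtAC_zero_iff]
  exact ⟨fun h => h.2, fun h => ⟨hsum, h⟩⟩

end Zero

/-! ## §3 What the transported residual pair READS at zero data -/
section Residual

variable {S : Scales L} {G : Type} [GaugeGroup G] [MeasurableSpace G] [HaarData G] (𝔊 : GroupModel G) (𝔠 : AlphaConsts L 𝔊.N)
  (X : ExternalInputsAC S G)

/-- ★ **R3D-01 ON THE AC ROAD AT ZERO DATA, UNFOLDED — (49) ≤ (55)·(58) IN TRANSPORTED FORM WITH THE FLUCTUATION INTEGRAL DELETED.**  At the zero series the residual row
`Fibre49AC` of the new history `h′` READS: the exact transport `T_k(Ū)` of «step weight × small-field factor × m_k × exp[−(1∕g_k²)A(U_k) − E_k + Z-terms + R_k]» is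
`dV`-a.e. at most the transport of «step weight × m_k» times «exp[−(1∕g_{k+1}²)A(U_{k+1}(V)) − E_k + (log σ₀ + d(𝔤) log g_k)·|B(Λ_{k+1}(h′))*| + Z-terms + R_k]» — print's
(55)·(58) with `log Z^{(k)}`, `Σ𝒫_j`, `log Fl` and `Pint` ALL ZERO: the (62) normalisation `(σ₀ g_k^{d(𝔤)})^{|B*|}` alone against the minimisers' Boltzmann factors, the masses
`m_k = massRecAC` (uncapped Radon–Nikodym transports) riding inside BOTH sides.  Not decided here for any `X`. [cite: Balaban1985UV3, (49)–(58) pp.268–270 + (62) p.271] -/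
theorem fibre49AC_zeroRun_iff (k : ℕ) (h' : Hist S.P (k + 1)) :
    Fibre49AC X 𝔠.lane.carrier (zeroRun 𝔊 𝔠) (fun _ => True) k (piecesWAC 𝔠.lane X (zeroRun 𝔊 𝔠) k) h' ↔
      (rnTransport (X.av k).avg (fun U =>
          stepWeight 𝔠.lane.carrier.M₁ (rcolOf S 𝔠.lane.carrier) (eps1Of S 𝔠.lane.carrier) (epsSOf S 𝔠.lane.carrier) k h' U *
            chiB 𝔠.lane.carrier.M₁ (rcolOf S 𝔠.lane.carrier) (eps1Of S 𝔠.lane.carrier) k h' U *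
            ((stdTowerInputAC X 𝔠.lane.carrier (zeroRun 𝔊 𝔠)).W.mass k h'.proj U *
              Real.exp (-(((stdTowerInputAC X 𝔠.lane.carrier (zeroRun 𝔊 𝔠)).towerWith fun _ => True).mainT k h'.proj U)
                - ((stdTowerInputAC X 𝔠.lane.carrier (zeroRun 𝔊 𝔠)).towerWith fun _ => True).Ecst k
                + ((stdTowerInputAC X 𝔠.lane.carrier (zeroRun 𝔊 𝔠)).towerWith fun _ => True).Zterm k h'.proj
                + ((stdTowerInputAC X 𝔠.lane.carrier (zeroRun 𝔊 𝔠)).towerWith fun _ => True).Rm k)))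
        ≤ᵐ[fieldMeasure S.P (k + 1) G] fun V =>
          rnTransport (X.av k).avg (fun U =>
              stepWeight 𝔠.lane.carrier.M₁ (rcolOf S 𝔠.lane.carrier) (eps1Of S 𝔠.lane.carrier) (epsSOf S 𝔠.lane.carrier) k h' U *
                (stdTowerInputAC X 𝔠.lane.carrier (zeroRun 𝔊 𝔠)).W.mass k h'.proj U) V *
            Real.exp (-(((stdTowerInputAC X 𝔠.lane.carrier (zeroRun 𝔊 𝔠)).towerWith fun _ => True).mainT (k + 1) h' V)
              - ((stdTowerInputAC X 𝔠.lane.carrier (zeroRun 𝔊 𝔠)).towerWith fun _ => True).Ecst k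
              + (𝔠.logσ₀ + (𝔠.dimg : ℝ) * Real.log (S.gk k)) * (piecesWAC 𝔠.lane X (zeroRun 𝔊 𝔠) k).starB h'
              + ((stdTowerInputAC X 𝔠.lane.carrier (zeroRun 𝔊 𝔠)).towerWith fun _ => True).Zterm k h'.proj
              + ((stdTowerInputAC X 𝔠.lane.carrier (zeroRun 𝔊 𝔠)).towerWith fun _ => True).Rm k)) := by
  unfold Fibre49AC
  simp only [stdTowerInputAC_zeroRun_Pint, piecesWAC_zeroRun_logZU, piecesWAC_zeroRun_Pold, piecesWAC_zeroRun_logFl, add_zero,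
    piecesWAC_zeroRun_logσ₀, piecesWAC_zeroRun_dg, piecesWAC_zeroRun_proj]

/-- ★ **R3D-02 ON THE AC ROAD AT ZERO DATA, UNFOLDED — THE LOWER STEP BOUND IN TRANSPORTED FORM WITH THE FLUCTUATION INTEGRAL DELETED**:
`χ_{k+1}(V)·exp[−(1∕g_{k+1}²)A(U_{k+1}(V)) − E_k + (log σ₀ + d(𝔤) log g_k)|T₁^{(k+1)*}| − R_k] ≤ T_k(Ū)[χ_k·exp(−(1∕g_k²)A(U_k) − E_k − R_k)](V)` a.e. — again the (62)
normalisation alone against the minimisers' Boltzmann factors and the exact transport. [cite: Balaban1985UV3, p.265 L21–28 + (47) p.267 + p.272 L32–33] -/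
theorem fibre57LowAC_zeroRun_iff (k : ℕ) :
    Fibre57LowAC X 𝔠.lane.carrier (zeroRun 𝔊 𝔠) (fun _ => True) k (piecesWAC 𝔠.lane X (zeroRun 𝔊 𝔠) k) ↔
      ((fun V => ((stdTowerInputAC X 𝔠.lane.carrier (zeroRun 𝔊 𝔠)).towerWith fun _ => True).chi (k + 1) V *
          Real.exp (-(((stdTowerInputAC X 𝔠.lane.carrier (zeroRun 𝔊 𝔠)).towerWith fun _ => True).mainT (k + 1) (Hist.triv S.P (k + 1)) V)
            - ((stdTowerInputAC X 𝔠.lane.carrier (zeroRun 𝔊 𝔠)).towerWith fun _ => True).Ecst k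
            + (𝔠.logσ₀ + (𝔠.dimg : ℝ) * Real.log (S.gk k)) * (piecesWAC 𝔠.lane X (zeroRun 𝔊 𝔠) k).starB (Hist.triv S.P (k + 1))
            - ((stdTowerInputAC X 𝔠.lane.carrier (zeroRun 𝔊 𝔠)).towerWith fun _ => True).Rm k))
        ≤ᵐ[fieldMeasure S.P (k + 1) G] rnTransport (X.av k).avg (fun U =>
          ((stdTowerInputAC X 𝔠.lane.carrier (zeroRun 𝔊 𝔠)).towerWith fun _ => True).chi k U *
            Real.exp (-(((stdTowerInputAC X 𝔠.lane.carrier (zeroRun 𝔊 𝔠)).towerWith fun _ => True).mainT k (Hist.triv S.P k) U)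
              - ((stdTowerInputAC X 𝔠.lane.carrier (zeroRun 𝔊 𝔠)).towerWith fun _ => True).Ecst k
              - ((stdTowerInputAC X 𝔠.lane.carrier (zeroRun 𝔊 𝔠)).towerWith fun _ => True).Rm k))) := by
  unfold Fibre57LowAC
  simp only [stdTowerInputAC_zeroRun_Pint, piecesWAC_zeroRun_logZU, piecesWAC_zeroRun_Pold, piecesWAC_zeroRun_logFl, add_zero,
    piecesWAC_zeroRun_logσ₀, piecesWAC_zeroRun_dg]

end Residual

end Summit.QuantumFields.YangMills.Theorems.BalabanUVNodesN08AlphaEq324RowACZeroRows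

end
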